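import Literature.AnabelianGeometry.EtaleTheta.TowerOfSetting
import Literature.AnabelianGeometry.EtaleTheta.RigidOfSetting
import Literature.AnabelianGeometry.EtaleTheta.ThetaSubquotientLevelNTwist
import HarnessLib

/-!
# [EtTh] §5, Theorem 5.7 (C)-display — the coefficient automorphisms `γ̄_M` INDUCED by `γ` on `(l·Δ_Θ) ⊗ ℤ/M`:
# the glue laws `hγμred`, `hγμχ` are THEOREMS for an induced family (Cor. 2.19 (iii) p.65; Thm. 5.6 proof p.329)

Mochizuki, *The étale theta function and its Frobenioid-theoretic manifestations*, Publ. RIMS **45** (2009)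
[cite: MochizukiEtTh2009, Cor 2.19 (iii) p.291 (PDF p.65); Thm 5.6 proof p.329 (PDF p.103); Cor 2.18 (i) p.286 (PDF p.60); §2 p.272 (PDF p.46)].
abc-iut cell, layer L2, node `EtTh:Thm5.7`; seat abc-iut-f-123 (gen 9), abc-iut-L2-lead R1311 «THM57-RESIDUAL-(3)» (VNEXT-CENSUS-L2
§G5 add. 16; abc-iut-L2-d4 g8 memo `MEMO-Thm57-K4m-currency-L2d4g8.md` §3 (c): «re-display `γμ_M` as the level-`M` DESCENT of `γ`, after which
`hγμχ`, `hγμred` become theorems»).  PROOF-ONLY (0 definitions, 0 instances, 0 notation, no new named fact; nothing landed is edited).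

WHAT.  The leanest Thm. 5.7 (C)-displays of record (abc-iut-f-123 p486421/p506863, abc-iut-L2-d4 p501804/p509212) carry the étale shadow
`(γ, γ_μ)` of `Ψ` as FREE data: `γ : Π^tp_X̲̲ ≃ₜ* Π^tp_X̲̲` and, for every level `M ∈ E`, `γμ M : μ_M ≃* μ_M`, tied together only by the two glue
binders `hγμχ` («`γ_μ,M ∘ χ_M(aug x) = χ_M(aug (γ x)) ∘ γ_μ,M`») and `hγμred` («`red ∘ γ_μ,M' = γ_μ,M ∘ red`»).  Print's `γ̄_M` is NOT free: it
is "the coefficient automorphism INDUCED by `γ` on `(l·Δ_Θ) ⊗ ℤ/M ≅ μ_M` (through `thetaMod`, Cor. 2.18 (i))" — EXACTLY the hypothesis shape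
of abc-iut-L2-t2's typed `ThetaEnvTower.Cor219_iii` (`ThetaSystems.lean`):
`∀ M (g : l·Δ_Θ) (hg : γ g ∈ l·Δ_Θ), thetaMod_M ⟨γ g, hg⟩ = γμ M (thetaMod_M g)`.  This file proves, for such an INDUCED family:
* `ThetaEnvTower.red_gammaMu_of_induced` — `hγμred` (any tower: `red ∘ thetaMod_{M'} = thetaMod_M`, `thetaMod` onto);
* `ThetaEnvTower.gammaMu_chi_of_induced` — `hγμχ` (any tower whose `thetaMod` is `Π^tp_X`-equivariant, displayed as `hconj`);
* `ThetaEnvTower.gammaMu_unique_of_induced` — the induced family is UNIQUE (so «`γ_μ := the descent of γ`» is a definite description);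
* at the tower OF THE SETTING `C.thetaEnvTower τ hC hS` (abc-iut-L2-t8): `thetaMod_conj_thetaEnvTower` (equivariance, from
  `CyclotomeMod.red_conj`), hence `hγμred_thetaEnvTower_of_induced` / `hγμχ_thetaEnvTower_of_induced` = the two display binders VERBATIM
  as theorems; `cor218_i_rigidData_iff` (Cor. 2.18 (i) at the Setting's rigidity data does not depend on the level identification
  `μ`: ONE `h218i` serves every level); `map_lDeltaTheta_of_cor218i` (`γ` preserves `l·Δ_Θ`); and
  `exists_gammaMu_induced_of_cor218i` — an induced family EXISTS at every level from Cor. 2.18 (i) alone (abc-iut-w5-d013's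
  `RigidData.exists_levelTwistData_of_cor218`, p438441, level by level).
CONSEQUENCE for the (C)-display: the binder triple {`γμ` free, `hγμχ`, `hγμred`} may be replaced by {`γμ`, `hind`} (print's induced
`γ̄_M`; inhabited given `h218i`), net −1 binder and +faithfulness; the companion file `Sec5Thm57K4mAtSettingTowerOfShadow.lean` then reads
(K4m) at `b` from the K4 junction book with `φΛ_M := γμ M`.
HONEST FRAMING: kernel-checked group theory over the typed interfaces; the anabelian content enters only through the NAMED input
`RigidData.Cor218_i` (F-0620, FACT-policy, never asserted here); [EtTh] is refereed pre-IUT material; typed ≠ proved; nothing here bears on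
[IUTchIII] Cor. 3.12 — no side taken; nothing asserts abc proved or refuted.
-/

noncomputable section

namespace Literature.AnabelianGeometry.EtaleTheta

open Literature.AnabelianGeometry.SemiGraphs

/-! ## 1. Generic towers: laws of an induced family `γ̄_M` -/

namespace ThetaEnvTower

universe u

variable {E : Set ℕ+} (T : ThetaEnvTower.{u} E)

/-- **`hγμred` is a theorem for an induced family** ("`M_{N'}` … induced by `M`", Def. 2.13 (ii); `red ∘ thetaMod_{M'} = thetaMod_M`):
if `γ̄_M` is induced by `γ` on `(l·Δ_Θ) ⊗ ℤ/M` at every level, then `red_{M',M} ∘ γ̄_{M'} = γ̄_M ∘ red_{M',M}`.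
[cite: MochizukiEtTh2009, Cor 2.19 (iii) p.291 (PDF p.65); Def 2.13 (ii) p.274 (PDF p.48)] -/
theorem red_gammaMu_of_induced (γ : T.PiX ≃ₜ* T.PiX) (γμ : ∀ M : E, T.mu M ≃* T.mu M)
    (hL : ∀ g : T.PiX, g ∈ T.lDeltaTheta → γ g ∈ T.lDeltaTheta)
    (hind : ∀ (M : E) (g : T.lDeltaTheta) (hg : γ g ∈ T.lDeltaTheta), T.thetaMod M ⟨γ g, hg⟩ = γμ M (T.thetaMod M g))
    (M M' : E) (hd : (M : ℕ+) ∣ M') (tt : T.mu M') :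
    T.red M M' hd (γμ M' tt) = γμ M (T.red M M' hd tt) := by
  obtain ⟨g, rfl⟩ := T.thetaMod_surjective M' tt
  rw [← hind M' g (hL g g.2), T.red_thetaMod, T.red_thetaMod, hind M g (hL g g.2)]

/-- **`hγμχ` is a theorem for an induced family over a tower with `Π^tp_X`-equivariant `thetaMod`** ("natural", p.272 (PDF p.46):
`thetaMod (x g x⁻¹) = χ(aug x) · thetaMod g`, displayed as `hconj`): `γ̄_M (χ_M(aug x) · t) = χ_M(aug (γ x)) · γ̄_M t`.
[cite: MochizukiEtTh2009, Cor 2.19 (iii) p.291 (PDF p.65); §2 p.272 (PDF p.46)] -/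
theorem gammaMu_chi_of_induced (γ : T.PiX ≃ₜ* T.PiX) (γμ : ∀ M : E, T.mu M ≃* T.mu M)
    (hL : ∀ g : T.PiX, g ∈ T.lDeltaTheta → γ g ∈ T.lDeltaTheta)
    (hind : ∀ (M : E) (g : T.lDeltaTheta) (hg : γ g ∈ T.lDeltaTheta), T.thetaMod M ⟨γ g, hg⟩ = γμ M (T.thetaMod M g))
    (hN : ∀ (x g : T.PiX), g ∈ T.lDeltaTheta → x * g * x⁻¹ ∈ T.lDeltaTheta)
    (hconj : ∀ (M : E) (x : T.PiX) (g : T.lDeltaTheta),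
      T.thetaMod M ⟨x * g * x⁻¹, hN x g g.2⟩ = T.chi M (T.aug x) (T.thetaMod M g))
    (M : E) (x : T.PiX) (tt : T.mu M) :
    γμ M (T.chi M (T.aug x) tt) = T.chi M (T.aug (γ x)) (γμ M tt) := by
  obtain ⟨g, rfl⟩ := T.thetaMod_surjective M tt
  rw [← hconj M x g, ← hind M _ (hL _ (hN x g g.2)), ← hind M g (hL g g.2),
    ← hconj M (γ x) ⟨γ g, hL g g.2⟩]
  congr 1
  apply Subtype.ext
  change γ (x * g * x⁻¹) = γ x * γ g * (γ x)⁻¹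
  rw [map_mul, map_mul, map_inv]

/-- **An induced family is unique** (`thetaMod_M` is onto): two families induced by the same `γ` coincide at every level — so
«`γ_μ,M :=` the automorphism induced by `γ`» is a definite description. [cite: MochizukiEtTh2009, Cor 2.19 (iii) p.291 (PDF p.65)] -/
theorem gammaMu_unique_of_induced (γ : T.PiX ≃ₜ* T.PiX) (γμ γμ' : ∀ M : E, T.mu M ≃* T.mu M)
    (hL : ∀ g : T.PiX, g ∈ T.lDeltaTheta → γ g ∈ T.lDeltaTheta)
    (hind : ∀ (M : E) (g : T.lDeltaTheta) (hg : γ g ∈ T.lDeltaTheta), T.thetaMod M ⟨γ g, hg⟩ = γμ M (T.thetaMod M g))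
    (hind' : ∀ (M : E) (g : T.lDeltaTheta) (hg : γ g ∈ T.lDeltaTheta), T.thetaMod M ⟨γ g, hg⟩ = γμ' M (T.thetaMod M g))
    (M : E) : γμ M = γμ' M := by
  refine MulEquiv.ext fun tt => ?_
  obtain ⟨g, rfl⟩ := T.thetaMod_surjective M tt
  rw [← hind M g (hL g g.2), hind' M g (hL g g.2)]

/-- Pointwise preservation of `l·Δ_Θ` from the subgroup equation `γ(l·Δ_Θ) = l·Δ_Θ` (the Cor. 2.18 (i) clause shape).
[cite: MochizukiEtTh2009, Cor 2.18 (i) p.286 (PDF p.60)] -/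
theorem apply_mem_lDeltaTheta_of_map_eq (γ : T.PiX ≃ₜ* T.PiX)
    (hγL : T.lDeltaTheta.map γ.toMulEquiv.toMonoidHom = T.lDeltaTheta) (g : T.PiX) (hg : g ∈ T.lDeltaTheta) :
    γ g ∈ T.lDeltaTheta := by
  rw [← hγL]
  exact ⟨g, hg, rfl⟩

end ThetaEnvTower

/-! ## 2. The tower OF THE SETTING (`C.thetaEnvTower τ hC hS`, abc-iut-L2-t8) -/

namespace ThetaSetting

namespace EtaleThetaData.DoubleUnderline

variable {p : ℕ} [Fact p.Prime] {D : ThetaSetting p} {E : D.EtaleThetaData} {l : ℕ} (C : E.DoubleUnderline l) {Es : Set ℕ+}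
  (τ : D.CyclotomeTower l Es)

/-- `l·Δ_Θ` (its inverse image in `Π^tp_X̲̲`) is normal — the tower's `lDeltaTheta` is the Setting's `comap` of `l·Δ_Θ ⊆ (Π^tp_X)^Θ`.
[cite: MochizukiEtTh2009, Prop 2.12 (i) p.271 (PDF p.45)] -/
theorem lDeltaTheta_thetaEnvTower_normal (hC : D.Compat) (hS : D.Sec2Hyps) : ((C.thetaEnvTower τ hC hS).lDeltaTheta).Normal :=
  (D.lDeltaTheta_normal l).comap _

/-- **`thetaMod_M` of the tower of the Setting is `Π^tp_X̲̲`-equivariant** ("the natural isomorphism `μ_N ≅ (l·Δ_Θ) ⊗ ℤ/Nℤ`", p.272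
(PDF p.46), `CyclotomeMod.red_conj`): `thetaMod_M (x g x⁻¹) = χ_M(aug x) · thetaMod_M g` — the `hconj` input of §1 at this tower (the same
computation as `rigidData.thetaMod_conj`, abc-iut-L2-t8, stated without the rigidity-data parameters).
[cite: MochizukiEtTh2009, §2 p.272 (PDF p.46)] -/
theorem thetaMod_conj_thetaEnvTower (hC : D.Compat) (hS : D.Sec2Hyps) (M : Es) (x : (C.thetaEnvTower τ hC hS).PiX)
    (g : (C.thetaEnvTower τ hC hS).lDeltaTheta) :
    (C.thetaEnvTower τ hC hS).thetaMod M ⟨x * g * x⁻¹, (C.lDeltaTheta_thetaEnvTower_normal τ hC hS).conj_mem _ g.2 x⟩ =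
      (C.thetaEnvTower τ hC hS).chi M ((C.thetaEnvTower τ hC hS).aug x) ((C.thetaEnvTower τ hC hS).thetaMod M g) := by
  change (τ.mod M).red (C.toLDelta _) = galMuN p M (D.aug.toMonoidHom ((x : C.Huu) : D.PiTemp)) ((τ.mod M).red (C.toLDelta g))
  rw [← (τ.mod M).red_conj]
  congr 1
  apply Subtype.ext
  rw [coe_toLDelta]
  change D.toTheta ((x * (g : C.Huu) * x⁻¹ : C.Huu) : D.PiTemp) = _
  rw [Subgroup.coe_mul, Subgroup.coe_mul, Subgroup.coe_inv, map_mul, map_mul, map_inv]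
  rfl

/-- **The display binder `hγμred` of the Thm. 5.7 (C)-displays (p486421/p506863/p509212) is a THEOREM for an induced family** at the
tower of the Setting. [cite: MochizukiEtTh2009, Cor 2.19 (iii) p.291 (PDF p.65); Thm 5.7 p.330 (PDF p.104)] -/
theorem hγμred_thetaEnvTower_of_induced (hC : D.Compat) (hS : D.Sec2Hyps)
    (γ : (C.thetaEnvTower τ hC hS).PiX ≃ₜ* (C.thetaEnvTower τ hC hS).PiX)
    (γμ : ∀ M : Es, (C.thetaEnvTower τ hC hS).mu M ≃* (C.thetaEnvTower τ hC hS).mu M)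
    (hL : ∀ g : (C.thetaEnvTower τ hC hS).PiX, g ∈ (C.thetaEnvTower τ hC hS).lDeltaTheta → γ g ∈ (C.thetaEnvTower τ hC hS).lDeltaTheta)
    (hind : ∀ (M : Es) (g : (C.thetaEnvTower τ hC hS).lDeltaTheta) (hg : γ g ∈ (C.thetaEnvTower τ hC hS).lDeltaTheta),
      (C.thetaEnvTower τ hC hS).thetaMod M ⟨γ g, hg⟩ = γμ M ((C.thetaEnvTower τ hC hS).thetaMod M g)) :
    ∀ (M M' : Es) (hd : (M : ℕ+) ∣ M') (tt : (C.thetaEnvTower τ hC hS).mu M'),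
      (C.thetaEnvTower τ hC hS).red M M' hd (γμ M' tt) = γμ M ((C.thetaEnvTower τ hC hS).red M M' hd tt) :=
  (C.thetaEnvTower τ hC hS).red_gammaMu_of_induced γ γμ hL hind

/-- **The display binder `hγμχ` of the Thm. 5.7 (C)-displays (p486421/p506863/p509212) is a THEOREM for an induced family** at the
tower of the Setting. [cite: MochizukiEtTh2009, Cor 2.19 (iii) p.291 (PDF p.65); Thm 5.7 p.330 (PDF p.104)] -/
theorem hγμχ_thetaEnvTower_of_induced (hC : D.Compat) (hS : D.Sec2Hyps)
    (γ : (C.thetaEnvTower τ hC hS).PiX ≃ₜ* (C.thetaEnvTower τ hC hS).PiX)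
    (γμ : ∀ M : Es, (C.thetaEnvTower τ hC hS).mu M ≃* (C.thetaEnvTower τ hC hS).mu M)
    (hL : ∀ g : (C.thetaEnvTower τ hC hS).PiX, g ∈ (C.thetaEnvTower τ hC hS).lDeltaTheta → γ g ∈ (C.thetaEnvTower τ hC hS).lDeltaTheta)
    (hind : ∀ (M : Es) (g : (C.thetaEnvTower τ hC hS).lDeltaTheta) (hg : γ g ∈ (C.thetaEnvTower τ hC hS).lDeltaTheta),
      (C.thetaEnvTower τ hC hS).thetaMod M ⟨γ g, hg⟩ = γμ M ((C.thetaEnvTower τ hC hS).thetaMod M g)) :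
    ∀ (M : Es) (x : (C.thetaEnvTower τ hC hS).PiX) (tt : (C.thetaEnvTower τ hC hS).mu M),
      γμ M ((C.thetaEnvTower τ hC hS).chi M ((C.thetaEnvTower τ hC hS).aug x) tt) =
        (C.thetaEnvTower τ hC hS).chi M ((C.thetaEnvTower τ hC hS).aug (γ x)) (γμ M tt) :=
  (C.thetaEnvTower τ hC hS).gammaMu_chi_of_induced γ γμ hL hind
    (fun x _ hg => (C.lDeltaTheta_thetaEnvTower_normal τ hC hS).conj_mem _ hg x)
    (fun M x g => C.thetaMod_conj_thetaEnvTower τ hC hS M x g)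

/-- **Cor. 2.18 (i) at the Setting's rigidity data does not depend on the level identification `μ`** (the subquotients `Π^tp_Y`,
`Π^tp_Ÿ`, `Δ_X`, `(Π^tp_X)^Θ`, `l·Δ_Θ` and the cusp labels are level-free): ONE `h218i` serves every level of the tower.
[cite: MochizukiEtTh2009, Cor 2.18 (i) p.286 (PDF p.60)] -/
theorem cor218_i_rigidData_iff (hC : D.Compat) (hS : D.Sec2Hyps) (h15 : Prop15iii E hC) (L : C.CuspLabels) {N N' : ℕ+}
    (μ : D.CyclotomeMod l N) (μ' : D.CyclotomeMod l N') :
    (C.rigidData μ hC hS h15 L).Cor218_i ↔ (C.rigidData μ' hC hS h15 L).Cor218_i :=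
  Iff.rfl

/-- **`γ` preserves `l·Δ_Θ`** at the tower of the Setting, from Cor. 2.18 (i) at ANY level identification (F-0620 BY NAME).
[cite: MochizukiEtTh2009, Cor 2.18 (i) p.286 (PDF p.60)] -/
theorem map_lDeltaTheta_thetaEnvTower_of_cor218i (hC : D.Compat) (hS : D.Sec2Hyps) (h15 : Prop15iii E hC) (L : C.CuspLabels)
    {N : ℕ+} (μ : D.CyclotomeMod l N) (h218i : (C.rigidData μ hC hS h15 L).Cor218_i)
    (γ : (C.thetaEnvTower τ hC hS).PiX ≃ₜ* (C.thetaEnvTower τ hC hS).PiX) :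
    ∀ g : (C.thetaEnvTower τ hC hS).PiX, g ∈ (C.thetaEnvTower τ hC hS).lDeltaTheta → γ g ∈ (C.thetaEnvTower τ hC hS).lDeltaTheta :=
  (C.thetaEnvTower τ hC hS).apply_mem_lDeltaTheta_of_map_eq γ (h218i γ).2.2.2.2.1

/-- **An induced family `γ̄_M` EXISTS at every level of the tower of the Setting** from Cor. 2.18 (i) alone: abc-iut-w5-d013's
`RigidData.exists_levelTwistData_of_cor218` (p438441) at the rigidity data `C.rigidData (τ.mod M) …` of each level (whose `thetaMod` IS the
tower's `thetaMod_M`).  With `gammaMu_unique_of_induced`: «the descent of `γ`» is a well-defined family.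
[cite: MochizukiEtTh2009, Thm 5.6 proof p.329 (PDF p.103); Cor 2.18 (i) p.286 (PDF p.60)] -/
theorem exists_gammaMu_induced_of_cor218i (hC : D.Compat) (hS : D.Sec2Hyps) (h15 : Prop15iii E hC) (L : C.CuspLabels)
    {N : ℕ+} (μ : D.CyclotomeMod l N) (h218i : (C.rigidData μ hC hS h15 L).Cor218_i)
    (γ : (C.thetaEnvTower τ hC hS).PiX ≃ₜ* (C.thetaEnvTower τ hC hS).PiX) :
    ∃ γμ : ∀ M : Es, (C.thetaEnvTower τ hC hS).mu M ≃* (C.thetaEnvTower τ hC hS).mu M,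
      ∀ (M : Es) (g : (C.thetaEnvTower τ hC hS).lDeltaTheta) (hg : γ g ∈ (C.thetaEnvTower τ hC hS).lDeltaTheta),
        (C.thetaEnvTower τ hC hS).thetaMod M ⟨γ g, hg⟩ = γμ M ((C.thetaEnvTower τ hC hS).thetaMod M g) := by
  have h := fun M : Es =>
    (C.rigidData (τ.mod M) hC hS h15 L).exists_levelTwistData_of_cor218 ((C.cor218_i_rigidData_iff hC hS h15 L μ (τ.mod M)).1 h218i)
      (ContinuousMulEquiv.refl _) γ
  choose φQ φΛ _hq _hι hΛ _hQ using h
  exact ⟨φΛ, fun M g hg => (hΛ M g hg).symm⟩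

end EtaleThetaData.DoubleUnderline

end ThetaSetting

end Literature.AnabelianGeometry.EtaleTheta

end
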